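/-
Copyright (c) 2026. All rights reserved.
Released under Apache 2.0 license as described in the file LICENSE.
-/
import Literature.Probability.LatticeModels.FKGEqualityChains
import Literature.Probability.LatticeModels.FKGEqualityLattice
import HarnessLib

/-!
# Equality in the FKG inequality on a product of finite chains — arbitrary support (Chan–Pak 2026, Thm. 9.1 in full)

CITATION HEADER.  Source: S. H. Chan, I. Pak, *Equality conditions for correlation inequalities*, arXiv:2607.06275
(July 2026) [ChanPak2026], read 2026-08-20 from corpus `paper:arxiv-2607.06275`:
* **Theorem 9.1** (p. 30), verbatim: "Let `L = (L, ∨, ∧)` be a direct product of `n` chains as in (8.5).  Let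
  `µ, f, g` be as in Theorem 1.5 [`µ : L → ℝ_{≥0}` log-supermodular, `f, g : L → ℝ` increasing].  Then (FKG) is
  an equality if and only if there exist a subset `A ⊆ [n]`, lattices `L₁ := ⊗_{i∈A} C_{N_i}`,
  `L₂ := ⊗_{j∉A} C_{N_j}`, functions `f′ : L₁ → ℝ`, `g′ : L₂ → ℝ`, such that
  `f(x₁,x₂) = f′(x₁)`, `g(x₁,x₂) = g′(x₂)` for all `(x₁,x₂) ∈ supp µ` (9.6), and measures
  `µ₁ : L₁ → ℝ_{≥0}`, `µ₂ : L₂ → ℝ_{≥0}`, such that `µ(x₁,x₂) = µ₁(x₁)µ₂(x₂)` for all `(x₁,x₂) ∈ L` (9.7).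
  The theorem is a direct consequence of Theorem 8.3.  Alternatively, it can be derived from Theorem 1.6 and
  Lemma 8.4 in the same way Theorem 8.3 is derived from Theorem 1.3.  We omit both proofs."
* **Remark 1.7** (p. 3): "Without the assumption that function `µ` is strictly positive, it follows from (1.3)
  log-supermodularity that `L′ := supp(µ)` is a distributive sublattice of `L`."
* **Lemma 8.4** (pp. 28–29): for finite distributive lattices `L₁, L₂` and an injective lattice homomorphism
  `ι : L₁ × L₂ → L = ⊗ C_{N_i}` with `(c₁,…,c_n) := ι(z₁,z₂)` (`z_k` the minima) there is `A ⊆ [n]` with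
  `ι(L₁ × {z₂}) = L₁* × {(c_j)_{j∉A}}` and `ι({z₁} × L₂) = {(c_i)_{i∈A}} × L₂*`; printed proof: with
  `(a_i) := ι(Z₁,z₂)`, `(C_i) := ι(Z₁,Z₂)` put `A := {i : a_i = C_i}` and squeeze
  `π₂ι(z₁,z₂) ≤ π₂ι(x₁,z₂) ≤ π₂ι(Z₁,z₂)`.

This file proves Theorem 9.1 IN FULL (`µ ≥ 0`, arbitrary support), completing
`Literature.Probability.LatticeModels.FKGEqualityChains` (which is the case `supp µ = L`), by EXACTLY the second
printed route: Remark 1.7 (`ne_zero_sup`, `ne_zero_inf`: the support is a sublattice) + Theorem 1.6 on the support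
sublattice (the tree theorem `FKGEqualityLattice.fkg_eq_iff_exists_prod`, [ChanPak2026, Thm. 1.6] for an
arbitrary finite distributive lattice) + Lemma 8.4 (this file, for an injective `⊔,⊓`-preserving map
`φ : L₁ × L₂ → Π_i α_i` from a product of bounded lattices into a product of chains: `alignedSet φ` is the printed
`A`; `apply_inl_of_not_mem_alignedSet` / `apply_inr_of_mem_alignedSet` are the two printed claims (8.6);
`apply_eq_inl_of_mem_alignedSet` / `apply_eq_inr_of_not_mem_alignedSet` the resulting coordinate description
`ι(x₁,x₂) = (ι(x₁,z₂)_A, ι(z₁,x₂)_{[n]−A})`; `fst_eq_of_agree_alignedSet` / `snd_eq_of_agree_alignedSet` its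
injectivity consequences) + the transport back to `L` (`exists_prod_supp_of_cov_eq_zero`).

## Main statements (no named facts; axioms `propext, Classical.choice, Quot.sound`)

* `exists_prod_supp_of_cov_eq_zero` — Thm. 9.1 `⇒` for `µ ≥ 0`: `Ω(f,g) = 0` gives `A ⊆ ι` and `f′, g′` with
  `DetBy f′ A`, `DetBy g′ Aᶜ`, `f = f′`, `g = g′` on `supp µ` (9.6), and `µ = µ₁·µ₂` on ALL of `L` with
  `µ₁ ≥ 0` determined by `A`, `µ₂ ≥ 0` by `Aᶜ` (9.7).
* `cov_eq_zero_of_prod_supp` — Thm. 9.1 `⇐`, for any weight.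
* `cov_eq_zero_iff_exists_prod_supp` — Thm. 9.1 verbatim as an `iff`; `ex_mul_eq_ex_mul_ex_iff_supp` — the
  normalised form for EVERY FKG probability weight (`IsFKGMeasure`, zeros allowed) on a product of finite chains;
  `cov_pos_of_forall_not_prod_supp` — strict FKG in this generality.
* (appended) `FKGEquality.cov_eq_zero_iff_exists_prod_supp`, `FKGEquality.ex_mul_eq_ex_mul_ex_iff_supp` — the
  same theorem on the Boolean lattice `2^ι = Π _ : ι, Prop` (chains of length two) in the vocabulary of
  `FKGEquality.lean` (`f′(ω) = f′(ω ∩ A)`, `µ(ω) = µ₁(ω ∩ A)·µ₂(ω ∖ A)`), completing that file's `µ > 0` statements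
  to `µ ≥ 0`; `FKGEquality.cov_pos_of_forall_not_prod_supp`, `FKGEquality.cov_pos_of_irreducible_supp` — strict
  FKG on `2^ι` for weights with zeros.

Here `cov µ f g = Σµ·Σµfg − Σµf·Σµg`, `DetBy h S` (`h(x₁,x₂) = h′(x₁)`), `IsLogSupermodular` are those of
`FKGEqualityChains.lean`.
-/

noncomputable section

open scoped Classical

namespace Literature.Probability.LatticeModels.FKGEqualityChains

open Finset Function
open Literature.Combinatorics.Sahi2008 (ex ex_def)

variable {ι : Type*} {α : ι → Type*}

/-! ### Lemma 8.4: a product sublattice of a product of chains is coordinate-aligned -/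

section Aligned

/-- A `⊔`-preserving map is monotone. [folklore] -/
private theorem monotone_of_map_sup {β γ : Type*} [SemilatticeSup β] [SemilatticeSup γ] {φ : β → γ}
    (hsup : ∀ p q, φ (p ⊔ q) = φ p ⊔ φ q) : Monotone φ := by
  intro p q hpq
  have h : φ q = φ p ⊔ φ q := by rw [← hsup, sup_eq_right.2 hpq]
  rw [h]
  exact le_sup_left

/-- In a linear order, `a ⊔ b = C` and `a ≠ C` force `b = C`. [folklore] -/
private theorem eq_of_sup_eq_of_ne {β : Type*} [LinearOrder β] {a b C : β} (h : a ⊔ b = C) (ha : a ≠ C) :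
    b = C := by
  rcases le_total a b with hab | hba
  · rwa [sup_eq_right.2 hab] at h
  · rw [sup_eq_left.2 hba] at h
    exact absurd h ha

variable {L₁ L₂ : Type*} [Lattice L₁] [Lattice L₂] [BoundedOrder L₁] [BoundedOrder L₂]

/-- The printed set `A := {i ∈ [n] : a_i = C_i}` of [ChanPak2026, Lemma 8.4], for a map `φ : L₁ × L₂ → Π_i α_i`
(`(a_i) := φ(Z₁, z₂)`, `(C_i) := φ(Z₁, Z₂)`, `Z/z` = top/bottom). [cite: ChanPak2026, Lemma 8.4 (proof, p. 29)] -/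
def alignedSet (φ : L₁ × L₂ → ∀ i, α i) : Set ι := {i | φ (⊤, ⊥) i = φ (⊤, ⊤) i}

/-- Membership in the aligned set, unfolded. [cite: ChanPak2026, Lemma 8.4 (proof, p. 29)] -/
theorem mem_alignedSet_iff (φ : L₁ × L₂ → ∀ i, α i) (i : ι) :
    i ∈ alignedSet φ ↔ φ (⊤, ⊥) i = φ (⊤, ⊤) i := Iff.rfl

variable [∀ i, LinearOrder (α i)] {φ : L₁ × L₂ → ∀ i, α i}

/-- **[ChanPak2026, Lemma 8.4], first claim of (8.6)**: off the aligned set, the fibre `φ(L₁ × {z₂})` is frozen at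
`φ(z₁,z₂)`.  Printed proof: `π₂φ(z₁,z₂) ≤ π₂φ(x₁,z₂) ≤ π₂φ(Z₁,z₂) = (c_j)_{j∉A}`.
[cite: ChanPak2026, Lemma 8.4] -/
theorem apply_inl_of_not_mem_alignedSet (hsup : ∀ p q, φ (p ⊔ q) = φ p ⊔ φ q)
    (hinf : ∀ p q, φ (p ⊓ q) = φ p ⊓ φ q) (x₁ : L₁) {i : ι} (hi : i ∉ alignedSet φ) :
    φ (x₁, ⊥) i = φ (⊥, ⊥) i := by
  have hmono := monotone_of_map_sup hsup
  -- `a ⊔ b = C`, `a ⊓ b = c`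
  have hab : φ (⊤, ⊥) ⊔ φ (⊥, ⊤) = φ (⊤, ⊤) := by
    rw [← hsup, Prod.mk_sup_mk, sup_bot_eq, bot_sup_eq]
  have hab' : φ (⊤, ⊥) ⊓ φ (⊥, ⊤) = φ (⊥, ⊥) := by
    rw [← hinf, Prod.mk_inf_mk, inf_bot_eq, bot_inf_eq]
  have haC : φ (⊤, ⊥) i ≤ φ (⊤, ⊤) i := hmono (Prod.mk_le_mk.2 ⟨le_rfl, bot_le⟩) i
  -- off `A`: `b_i = C_i`, hence `c_i = a_i ⊓ C_i = a_i`
  have hbi : φ (⊥, ⊤) i = φ (⊤, ⊤) i :=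
    eq_of_sup_eq_of_ne (by rw [← Pi.sup_apply, hab]) hi
  have hci : φ (⊥, ⊥) i = φ (⊤, ⊥) i := by
    rw [← hab', Pi.inf_apply, hbi, inf_eq_left.2 haC]
  -- squeeze `c ≤ φ(x₁,⊥) ≤ a`
  have h1 : φ (⊥, ⊥) i ≤ φ (x₁, ⊥) i := hmono (Prod.mk_le_mk.2 ⟨bot_le, le_rfl⟩) i
  have h2 : φ (x₁, ⊥) i ≤ φ (⊤, ⊥) i := hmono (Prod.mk_le_mk.2 ⟨le_top, le_rfl⟩) i
  exact le_antisymm (h2.trans hci.symm.le) h1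

/-- **[ChanPak2026, Lemma 8.4], second claim of (8.6)**: on the aligned set, the fibre `φ({z₁} × L₂)` is frozen at
`φ(z₁,z₂)`. [cite: ChanPak2026, Lemma 8.4] -/
theorem apply_inr_of_mem_alignedSet (hsup : ∀ p q, φ (p ⊔ q) = φ p ⊔ φ q)
    (hinf : ∀ p q, φ (p ⊓ q) = φ p ⊓ φ q) (x₂ : L₂) {i : ι} (hi : i ∈ alignedSet φ) :
    φ (⊥, x₂) i = φ (⊥, ⊥) i := by
  have hmono := monotone_of_map_sup hsup
  have hab' : φ (⊤, ⊥) ⊓ φ (⊥, ⊤) = φ (⊥, ⊥) := by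
    rw [← hinf, Prod.mk_inf_mk, inf_bot_eq, bot_inf_eq]
  have hbC : φ (⊥, ⊤) i ≤ φ (⊤, ⊤) i := hmono (Prod.mk_le_mk.2 ⟨bot_le, le_rfl⟩) i
  -- on `A`: `a_i = C_i`, hence `c_i = C_i ⊓ b_i = b_i`
  have hci : φ (⊥, ⊥) i = φ (⊥, ⊤) i := by
    rw [← hab', Pi.inf_apply, (mem_alignedSet_iff φ i).1 hi, inf_eq_right.2 hbC]
  have h1 : φ (⊥, ⊥) i ≤ φ (⊥, x₂) i := hmono (Prod.mk_le_mk.2 ⟨le_rfl, bot_le⟩) i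
  have h2 : φ (⊥, x₂) i ≤ φ (⊥, ⊤) i := hmono (Prod.mk_le_mk.2 ⟨le_rfl, le_top⟩) i
  exact le_antisymm (h2.trans hci.symm.le) h1

/-- **[ChanPak2026, Lemma 8.4], coordinate description**: on `A` the point `φ(x₁,x₂)` agrees with `φ(x₁,z₂)`
(so `φ(L₁ × L₂) = L₁* × L₂*` is coordinate-aligned). [cite: ChanPak2026, Lemma 8.4] -/
theorem apply_eq_inl_of_mem_alignedSet (hsup : ∀ p q, φ (p ⊔ q) = φ p ⊔ φ q)
    (hinf : ∀ p q, φ (p ⊓ q) = φ p ⊓ φ q) (p : L₁ × L₂) {i : ι} (hi : i ∈ alignedSet φ) :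
    φ p i = φ (p.1, ⊥) i := by
  have hmono := monotone_of_map_sup hsup
  have hp : p = (p.1, ⊥) ⊔ (⊥, p.2) := by
    rw [Prod.mk_sup_mk, sup_bot_eq, bot_sup_eq]
  have hle : φ (⊥, p.2) i ≤ φ (p.1, ⊥) i := by
    rw [apply_inr_of_mem_alignedSet hsup hinf p.2 hi]
    exact hmono (Prod.mk_le_mk.2 ⟨bot_le, le_rfl⟩) i
  conv_lhs => rw [hp, hsup, Pi.sup_apply]
  exact sup_eq_left.2 hle

/-- **[ChanPak2026, Lemma 8.4], coordinate description**: off `A` the point `φ(x₁,x₂)` agrees with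
`φ(z₁,x₂)`. [cite: ChanPak2026, Lemma 8.4] -/
theorem apply_eq_inr_of_not_mem_alignedSet (hsup : ∀ p q, φ (p ⊔ q) = φ p ⊔ φ q)
    (hinf : ∀ p q, φ (p ⊓ q) = φ p ⊓ φ q) (p : L₁ × L₂) {i : ι} (hi : i ∉ alignedSet φ) :
    φ p i = φ (⊥, p.2) i := by
  have hmono := monotone_of_map_sup hsup
  have hp : p = (p.1, ⊥) ⊔ (⊥, p.2) := by
    rw [Prod.mk_sup_mk, sup_bot_eq, bot_sup_eq]
  have hle : φ (p.1, ⊥) i ≤ φ (⊥, p.2) i := by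
    rw [apply_inl_of_not_mem_alignedSet hsup hinf p.1 hi]
    exact hmono (Prod.mk_le_mk.2 ⟨le_rfl, bot_le⟩) i
  conv_lhs => rw [hp, hsup, Pi.sup_apply]
  exact sup_eq_right.2 hle

/-- Consequence of Lemma 8.4 for an INJECTIVE `φ`: the `L₁`-component of a point of the product sublattice is
read off from its `A`-coordinates. [cite: ChanPak2026, Lemma 8.4] -/
theorem fst_eq_of_agree_alignedSet (hsup : ∀ p q, φ (p ⊔ q) = φ p ⊔ φ q)
    (hinf : ∀ p q, φ (p ⊓ q) = φ p ⊓ φ q) (hinj : Injective φ) {p q : L₁ × L₂}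
    (h : ∀ i ∈ alignedSet φ, φ p i = φ q i) : p.1 = q.1 := by
  have key : φ (p.1, ⊥) = φ (q.1, ⊥) := by
    funext i
    by_cases hi : i ∈ alignedSet φ
    · rw [← apply_eq_inl_of_mem_alignedSet hsup hinf p hi, ← apply_eq_inl_of_mem_alignedSet hsup hinf q hi]
      exact h i hi
    · rw [apply_inl_of_not_mem_alignedSet hsup hinf p.1 hi, apply_inl_of_not_mem_alignedSet hsup hinf q.1 hi]
  exact (Prod.mk.inj (hinj key)).1

/-- Consequence of Lemma 8.4 for an INJECTIVE `φ`: the `L₂`-component is read off from the coordinates off `A`.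
[cite: ChanPak2026, Lemma 8.4] -/
theorem snd_eq_of_agree_alignedSet (hsup : ∀ p q, φ (p ⊔ q) = φ p ⊔ φ q)
    (hinf : ∀ p q, φ (p ⊓ q) = φ p ⊓ φ q) (hinj : Injective φ) {p q : L₁ × L₂}
    (h : ∀ i ∉ alignedSet φ, φ p i = φ q i) : p.2 = q.2 := by
  have key : φ (⊥, p.2) = φ (⊥, q.2) := by
    funext i
    by_cases hi : i ∈ alignedSet φ
    · rw [apply_inr_of_mem_alignedSet hsup hinf p.2 hi, apply_inr_of_mem_alignedSet hsup hinf q.2 hi]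
    · rw [← apply_eq_inr_of_not_mem_alignedSet hsup hinf p hi,
        ← apply_eq_inr_of_not_mem_alignedSet hsup hinf q hi]
      exact h i hi
  exact (Prod.mk.inj (hinj key)).2

/-- Gluing: `φ(x₁, y₂)` has the `A`-coordinates of `φ(x₁,x₂)` and the remaining coordinates of `φ(y₁,y₂)`.
[cite: ChanPak2026, Lemma 8.4] -/
theorem apply_mk_fst_snd (hsup : ∀ p q, φ (p ⊔ q) = φ p ⊔ φ q) (hinf : ∀ p q, φ (p ⊓ q) = φ p ⊓ φ q)
    (p q : L₁ × L₂) (i : ι) :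
    φ (p.1, q.2) i = if i ∈ alignedSet φ then φ p i else φ q i := by
  split_ifs with hi
  · rw [apply_eq_inl_of_mem_alignedSet hsup hinf (p.1, q.2) hi, apply_eq_inl_of_mem_alignedSet hsup hinf p hi]
  · rw [apply_eq_inr_of_not_mem_alignedSet hsup hinf (p.1, q.2) hi,
      apply_eq_inr_of_not_mem_alignedSet hsup hinf q hi]

end Aligned

/-! ### Remark 1.7: the support of a log-supermodular weight is a sublattice; sums live on the support -/

section Support

variable [Fintype ι] [DecidableEq ι] [∀ i, Fintype (α i)] [∀ i, LinearOrder (α i)]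

omit [Fintype ι] [DecidableEq ι] [∀ i, Fintype (α i)] in
/-- **[ChanPak2026, Remark 1.7]**: the support of a log-supermodular `µ ≥ 0` is closed under `∨`.
[cite: ChanPak2026, Remark 1.7] -/
theorem ne_zero_sup {μ : (∀ i, α i) → ℝ} (hμ0 : ∀ x, 0 ≤ μ x) (hμ : IsLogSupermodular μ) {a b : ∀ i, α i}
    (ha : μ a ≠ 0) (hb : μ b ≠ 0) : μ (a ⊔ b) ≠ 0 := by
  intro h
  have hlt : 0 < μ a * μ b := mul_pos (lt_of_le_of_ne (hμ0 a) (Ne.symm ha)) (lt_of_le_of_ne (hμ0 b) (Ne.symm hb))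
  have := hμ a b
  rw [h, mul_zero] at this
  exact absurd this (not_le.2 hlt)

omit [Fintype ι] [DecidableEq ι] [∀ i, Fintype (α i)] in
/-- **[ChanPak2026, Remark 1.7]**: the support of a log-supermodular `µ ≥ 0` is closed under `∧`.
[cite: ChanPak2026, Remark 1.7] -/
theorem ne_zero_inf {μ : (∀ i, α i) → ℝ} (hμ0 : ∀ x, 0 ≤ μ x) (hμ : IsLogSupermodular μ) {a b : ∀ i, α i}
    (ha : μ a ≠ 0) (hb : μ b ≠ 0) : μ (a ⊓ b) ≠ 0 := by
  intro h
  have hlt : 0 < μ a * μ b := mul_pos (lt_of_le_of_ne (hμ0 a) (Ne.symm ha)) (lt_of_le_of_ne (hμ0 b) (Ne.symm hb))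
  have := hμ a b
  rw [h, zero_mul] at this
  exact absurd this (not_le.2 hlt)

omit [∀ i, LinearOrder (α i)] in
/-- "We can always restrict the inequality to `L′ = supp µ`": a `µ`-weighted sum over `L` is the same sum over the
support. [cite: ChanPak2026, Remark 1.7] -/
theorem sum_mul_eq_sum_subtype (μ h : (∀ i, α i) → ℝ) :
    ∑ x, μ x * h x = ∑ s : {x // μ x ≠ 0}, μ s * h s := by
  have h1 : ∑ x ∈ (univ.filter fun x => μ x ≠ 0), μ x * h x = ∑ x, μ x * h x :=
    sum_filter_of_ne fun x _ hne h0 => hne (by rw [h0, zero_mul])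
  rw [← h1, sum_subtype (univ.filter fun x => μ x ≠ 0) (p := fun x => μ x ≠ 0)
    (fun x => by simp only [mem_filter, mem_univ, true_and])]

omit [∀ i, LinearOrder (α i)] in
/-- `Ω(f,g)` only sees `f, g` on the support of `µ` ("we can always restrict the inequality to `L′`").
[cite: ChanPak2026, Remark 1.7] -/
theorem cov_congr_supp {μ f g f' g' : (∀ i, α i) → ℝ} (hf : ∀ x, μ x ≠ 0 → f x = f' x)
    (hg : ∀ x, μ x ≠ 0 → g x = g' x) : cov μ f g = cov μ f' g' := by
  have pt : ∀ (k k' : (∀ i, α i) → ℝ), (∀ x, μ x ≠ 0 → k x = k' x) → ∀ x, μ x * k x = μ x * k' x :=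
    fun k k' hk x => by
      by_cases hx : μ x = 0
      · rw [hx, zero_mul, zero_mul]
      · rw [hk x hx]
  have e1 : ex μ (f * g) = ex μ (f' * g') := by
    simp only [ex, Pi.mul_apply]
    exact sum_congr rfl fun x _ => pt (f * g) (f' * g') (fun y hy => by rw [Pi.mul_apply, Pi.mul_apply, hf y hy, hg y hy]) x
  have e2 : ex μ f = ex μ f' := sum_congr rfl fun x _ => pt f f' hf x
  have e3 : ex μ g = ex μ g' := sum_congr rfl fun x _ => pt g g' hg x
  rw [cov, cov, e1, e2, e3]

/-! ### Theorem 9.1 in full -/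

/-- **Chan–Pak 2026, Theorem 9.1, direction `⇒`, for an ARBITRARY log-supermodular `µ ≥ 0` on a product of
finite chains** (the support may be a proper sublattice): if `f, g` are increasing and `Σµ·Σµfg = Σµf·Σµg`, then
for some set `A` of coordinates, `f = f′` and `g = g′` on `supp µ` with `f′` determined by the coordinates in `A`
and `g′` by those outside `A` (9.6), and `µ(x) = µ₁(x_A)·µ₂(x_{Aᶜ})` on all of `L` with `µ₁, µ₂ ≥ 0` (9.7).
Proof = the second printed route: Remark 1.7, Theorem 1.6 on the support sublattice
(`FKGEqualityLattice.fkg_eq_iff_exists_prod`), Lemma 8.4 (`alignedSet` …), transport.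
[cite: ChanPak2026, Thm. 9.1] -/
theorem exists_prod_supp_of_cov_eq_zero {μ f g : (∀ i, α i) → ℝ} (hμ0 : ∀ x, 0 ≤ μ x)
    (hμ : IsLogSupermodular μ) (hf : Monotone f) (hg : Monotone g) (hcov : cov μ f g = 0) :
    ∃ A : Set ι,
      (∃ f' : (∀ i, α i) → ℝ, DetBy f' A ∧ ∀ x, μ x ≠ 0 → f x = f' x) ∧
      (∃ g' : (∀ i, α i) → ℝ, DetBy g' Aᶜ ∧ ∀ x, μ x ≠ 0 → g x = g' x) ∧
      ∃ μ₁ μ₂ : (∀ i, α i) → ℝ, (∀ x, 0 ≤ μ₁ x) ∧ (∀ x, 0 ≤ μ₂ x) ∧ DetBy μ₁ A ∧ DetBy μ₂ Aᶜ ∧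
        ∀ x, μ x = μ₁ x * μ₂ x := by
  -- the empty support
  by_cases hne : ∃ x, μ x ≠ 0
  swap
  · have hne' : ∀ x, μ x = 0 := fun x => by_contra fun h => hne ⟨x, h⟩
    exact ⟨Set.univ, ⟨f, DetBy.univ f, fun x _ => rfl⟩, ⟨fun _ => 0, fun _ _ _ => rfl, fun x hx => absurd (hne' x) hx⟩,
      μ, fun _ => 1, hμ0, fun _ => zero_le_one, DetBy.univ μ, fun _ _ _ => rfl, fun x => (mul_one _).symm⟩
  obtain ⟨x₀, hx₀⟩ := hne
  -- Remark 1.7: the support sublattice `L′`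
  have Psup : ∀ ⦃s t : ∀ i, α i⦄, μ s ≠ 0 → μ t ≠ 0 → μ (s ⊔ t) ≠ 0 := fun s t hs ht => ne_zero_sup hμ0 hμ hs ht
  have Pinf : ∀ ⦃s t : ∀ i, α i⦄, μ s ≠ 0 → μ t ≠ 0 → μ (s ⊓ t) ≠ 0 := fun s t hs ht => ne_zero_inf hμ0 hμ hs ht
  letI : DistribLattice {x : ∀ i, α i // μ x ≠ 0} := Subtype.distribLattice Psup Pinf
  -- the restricted data satisfy the hypotheses of Theorem 1.6
  have hposS : ∀ s : {x : ∀ i, α i // μ x ≠ 0}, 0 < μ s := fun s => lt_of_le_of_ne (hμ0 s) (Ne.symm s.2)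
  have hμS : ∀ a b : {x : ∀ i, α i // μ x ≠ 0},
      μ a * μ b ≤ μ (↑(a ⊓ b) : ∀ i, α i) * μ (↑(a ⊔ b) : ∀ i, α i) := fun a b => hμ a b
  have hfS : Monotone (fun s : {x : ∀ i, α i // μ x ≠ 0} => f s) := fun a b hab => hf hab
  have hgS : Monotone (fun s : {x : ∀ i, α i // μ x ≠ 0} => g s) := fun a b hab => hg hab
  have heqS : (∑ s : {x : ∀ i, α i // μ x ≠ 0}, μ s * f s) * (∑ s : {x : ∀ i, α i // μ x ≠ 0}, μ s * g s) =
      (∑ s : {x : ∀ i, α i // μ x ≠ 0}, μ s * (f s * g s)) * ∑ s : {x : ∀ i, α i // μ x ≠ 0}, μ s := by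
    have h0 : ∑ x, μ x = ∑ s : {x : ∀ i, α i // μ x ≠ 0}, μ s := by
      simpa only [mul_one] using sum_mul_eq_sum_subtype μ (fun _ => 1)
    have h3 : ∑ x, μ x * (f x * g x) = ∑ s : {x : ∀ i, α i // μ x ≠ 0}, μ s * (f s * g s) :=
      sum_mul_eq_sum_subtype μ (fun x => f x * g x)
    rw [← sum_mul_eq_sum_subtype μ f, ← sum_mul_eq_sum_subtype μ g, ← h3, ← h0]
    have h := hcov
    simp only [cov, ex, Pi.mul_apply, sub_eq_zero] at h
    rw [← h]
    exact mul_comm _ _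
  obtain ⟨L₁, L₂, _, _, _, _, e, f', g', μ₁, μ₂, hμ₁, hμ₂, hf', hg', hμ'⟩ :=
    (FKGEqualityLattice.fkg_eq_iff_exists_prod (fun s : {x : ∀ i, α i // μ x ≠ 0} => μ s)
      (fun s => f s) (fun s => g s) hposS hμS hfS hgS).1 heqS
  -- the factors are nonempty finite lattices: bounded
  haveI : Nonempty L₁ := ⟨(e ⟨x₀, hx₀⟩).1⟩
  haveI : Nonempty L₂ := ⟨(e ⟨x₀, hx₀⟩).2⟩
  letI : BoundedOrder L₁ := Fintype.toBoundedOrder L₁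
  letI : BoundedOrder L₂ := Fintype.toBoundedOrder L₂
  -- Lemma 8.4 for the lattice embedding `φ = e⁻¹ : L₁ × L₂ → supp µ ⊆ L`
  set φ : L₁ × L₂ → ∀ i, α i := fun p => ((e.symm p : {x : ∀ i, α i // μ x ≠ 0}) : ∀ i, α i) with hφ
  have hsup : ∀ p q, φ (p ⊔ q) = φ p ⊔ φ q := fun p q => by
    simp only [hφ, OrderIso.map_sup]; rfl
  have hinf : ∀ p q, φ (p ⊓ q) = φ p ⊓ φ q := fun p q => by
    simp only [hφ, OrderIso.map_inf]; rfl
  have hinj : Injective φ := fun p q h => e.symm.injective (Subtype.ext h)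
  have hφe : ∀ s : {x : ∀ i, α i // μ x ≠ 0}, φ (e s) = s := fun s => by
    simp only [hφ, OrderIso.symm_apply_apply]
  have hφP : ∀ p, μ (φ p) ≠ 0 := fun p => (e.symm p).2
  set A : Set ι := alignedSet φ with hA
  -- witnesses: points of `L₁ × L₂` whose image agrees with `x` on `A` (resp. off `A`)
  have hwit₁ : ∀ s : {x : ∀ i, α i // μ x ≠ 0}, ∃ p : L₁ × L₂, ∀ i ∈ A, φ p i = (s : ∀ i, α i) i :=
    fun s => ⟨e s, fun i _ => by rw [hφe]⟩
  have hwit₂ : ∀ s : {x : ∀ i, α i // μ x ≠ 0}, ∃ p : L₁ × L₂, ∀ i ∉ A, φ p i = (s : ∀ i, α i) i :=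
    fun s => ⟨e s, fun i _ => by rw [hφe]⟩
  have hfst : ∀ (s : {x : ∀ i, α i // μ x ≠ 0}) (h : ∃ p : L₁ × L₂, ∀ i ∈ A, φ p i = (s : ∀ i, α i) i),
      h.choose.1 = (e s).1 := fun s h =>
    fst_eq_of_agree_alignedSet hsup hinf hinj fun i hi => by rw [h.choose_spec i hi, hφe]
  have hsnd : ∀ (s : {x : ∀ i, α i // μ x ≠ 0}) (h : ∃ p : L₁ × L₂, ∀ i ∉ A, φ p i = (s : ∀ i, α i) i),
      h.choose.2 = (e s).2 := fun s h =>
    snd_eq_of_agree_alignedSet hsup hinf hinj fun i hi => by rw [h.choose_spec i hi, hφe]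
  -- transported functions: value of `F′ ∘ pr₁ ∘ e` at any witness, `0` where there is none
  have hdet₁ : ∀ F : L₁ → ℝ, DetBy (fun x : ∀ i, α i =>
      if h : ∃ p : L₁ × L₂, ∀ i ∈ A, φ p i = x i then F h.choose.1 else 0) A := by
    intro F x y hxy
    by_cases hx : ∃ p : L₁ × L₂, ∀ i ∈ A, φ p i = x i
    · have hy : ∃ p : L₁ × L₂, ∀ i ∈ A, φ p i = y i := hx.imp fun p hp i hi => (hp i hi).trans (hxy i hi)
      simp only [dif_pos hx, dif_pos hy]
      congr 1
      exact fst_eq_of_agree_alignedSet hsup hinf hinj fun i hi => by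
        rw [hx.choose_spec i hi, hy.choose_spec i hi, hxy i hi]
    · have hy : ¬∃ p : L₁ × L₂, ∀ i ∈ A, φ p i = y i :=
        fun hy => hx (hy.imp fun p hp i hi => (hp i hi).trans (hxy i hi).symm)
      simp only [dif_neg hx, dif_neg hy]
  have hdet₂ : ∀ F : L₂ → ℝ, DetBy (fun x : ∀ i, α i =>
      if h : ∃ p : L₁ × L₂, ∀ i ∉ A, φ p i = x i then F h.choose.2 else 0) Aᶜ := by
    intro F x y hxy
    by_cases hx : ∃ p : L₁ × L₂, ∀ i ∉ A, φ p i = x i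
    · have hy : ∃ p : L₁ × L₂, ∀ i ∉ A, φ p i = y i := hx.imp fun p hp i hi => (hp i hi).trans (hxy i hi)
      simp only [dif_pos hx, dif_pos hy]
      congr 1
      exact snd_eq_of_agree_alignedSet hsup hinf hinj fun i hi => by
        rw [hx.choose_spec i hi, hy.choose_spec i hi, hxy i hi]
    · have hy : ¬∃ p : L₁ × L₂, ∀ i ∉ A, φ p i = y i :=
        fun hy => hx (hy.imp fun p hp i hi => (hp i hi).trans (hxy i hi).symm)
      simp only [dif_neg hx, dif_neg hy]
  have hval₁ : ∀ (F : L₁ → ℝ) (x : ∀ i, α i) (hx : μ x ≠ 0),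
      (if h : ∃ p : L₁ × L₂, ∀ i ∈ A, φ p i = x i then F h.choose.1 else 0) = F (e ⟨x, hx⟩).1 := by
    intro F x hx
    rw [dif_pos (hwit₁ ⟨x, hx⟩), hfst ⟨x, hx⟩]
  have hval₂ : ∀ (F : L₂ → ℝ) (x : ∀ i, α i) (hx : μ x ≠ 0),
      (if h : ∃ p : L₁ × L₂, ∀ i ∉ A, φ p i = x i then F h.choose.2 else 0) = F (e ⟨x, hx⟩).2 := by
    intro F x hx
    rw [dif_pos (hwit₂ ⟨x, hx⟩), hsnd ⟨x, hx⟩]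
  refine ⟨A, ⟨_, hdet₁ f', fun x hx => by rw [hval₁ f' x hx]; exact hf' ⟨x, hx⟩⟩,
    ⟨_, hdet₂ g', fun x hx => by rw [hval₂ g' x hx]; exact hg' ⟨x, hx⟩⟩,
    (fun x => if h : ∃ p : L₁ × L₂, ∀ i ∈ A, φ p i = x i then μ₁ h.choose.1 else 0),
    (fun x => if h : ∃ p : L₁ × L₂, ∀ i ∉ A, φ p i = x i then μ₂ h.choose.2 else 0),
    fun x => ?_, fun x => ?_, hdet₁ μ₁, hdet₂ μ₂, fun x => ?_⟩
  · show 0 ≤ (if h : ∃ p : L₁ × L₂, ∀ i ∈ A, φ p i = x i then μ₁ h.choose.1 else 0)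
    by_cases h : ∃ p : L₁ × L₂, ∀ i ∈ A, φ p i = x i
    · rw [dif_pos h]; exact (hμ₁ _).le
    · rw [dif_neg h]
  · show 0 ≤ (if h : ∃ p : L₁ × L₂, ∀ i ∉ A, φ p i = x i then μ₂ h.choose.2 else 0)
    by_cases h : ∃ p : L₁ × L₂, ∀ i ∉ A, φ p i = x i
    · rw [dif_pos h]; exact (hμ₂ _).le
    · rw [dif_neg h]
  · -- (9.7) on all of `L`
    show μ x = (if h : ∃ p : L₁ × L₂, ∀ i ∈ A, φ p i = x i then μ₁ h.choose.1 else 0) *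
      (if h : ∃ p : L₁ × L₂, ∀ i ∉ A, φ p i = x i then μ₂ h.choose.2 else 0)
    by_cases hx : μ x ≠ 0
    · rw [hval₁ μ₁ x hx, hval₂ μ₂ x hx]
      exact hμ' ⟨x, hx⟩
    · replace hx : μ x = 0 := not_ne_iff.1 hx
      by_cases h1 : ∃ p : L₁ × L₂, ∀ i ∈ A, φ p i = x i
      · by_cases h2 : ∃ p : L₁ × L₂, ∀ i ∉ A, φ p i = x i
        · -- both witnesses glue to a point of the support equal to `x`
          exfalso
          have hglue : φ (h1.choose.1, h2.choose.2) = x := by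
            funext i
            rw [apply_mk_fst_snd hsup hinf]
            split_ifs with hi
            · exact h1.choose_spec i hi
            · exact h2.choose_spec i hi
          exact hφP _ (hglue ▸ hx)
        · rw [hx, dif_neg h2, mul_zero]
      · rw [hx, dif_neg h1, zero_mul]

omit [∀ i, LinearOrder (α i)] in
/-- **Chan–Pak 2026, Theorem 9.1, direction `⇐`** (for ANY weight): the data (9.6)–(9.7) force
`Σµ·Σµfg = Σµf·Σµg`. [cite: ChanPak2026, Thm. 9.1 (⇐)] -/
theorem cov_eq_zero_of_prod_supp {μ f g f' g' μ₁ μ₂ : (∀ i, α i) → ℝ} {A : Set ι} (hf' : DetBy f' A)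
    (hf : ∀ x, μ x ≠ 0 → f x = f' x) (hg' : DetBy g' Aᶜ) (hg : ∀ x, μ x ≠ 0 → g x = g' x)
    (h₁ : DetBy μ₁ A) (h₂ : DetBy μ₂ Aᶜ) (hμ : ∀ x, μ x = μ₁ x * μ₂ x) : cov μ f g = 0 := by
  rw [cov_congr_supp hf hg]
  exact cov_eq_zero_of_split hf' hg' (Splits.of_prod h₁ h₂ hμ)

/-- **Chan–Pak 2026, Theorem 9.1 verbatim (product of finite chains, `µ ≥ 0` log-supermodular, arbitrary
support).**  For increasing `f, g`:  `Σµ·Σµfg − Σµf·Σµg = 0 ⟺ ∃ A ⊆ ι`, `f′(x_A)`, `g′(x_{Aᶜ})` with `f = f′`,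
`g = g′` on `supp µ` (9.6), and `µ₁(x_A), µ₂(x_{Aᶜ}) ≥ 0` with `µ = µ₁µ₂` on `L` (9.7).
[cite: ChanPak2026, Thm. 9.1] -/
theorem cov_eq_zero_iff_exists_prod_supp {μ f g : (∀ i, α i) → ℝ} (hμ0 : ∀ x, 0 ≤ μ x)
    (hμ : IsLogSupermodular μ) (hf : Monotone f) (hg : Monotone g) :
    cov μ f g = 0 ↔ ∃ A : Set ι,
      (∃ f' : (∀ i, α i) → ℝ, DetBy f' A ∧ ∀ x, μ x ≠ 0 → f x = f' x) ∧
      (∃ g' : (∀ i, α i) → ℝ, DetBy g' Aᶜ ∧ ∀ x, μ x ≠ 0 → g x = g' x) ∧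
      ∃ μ₁ μ₂ : (∀ i, α i) → ℝ, (∀ x, 0 ≤ μ₁ x) ∧ (∀ x, 0 ≤ μ₂ x) ∧ DetBy μ₁ A ∧ DetBy μ₂ Aᶜ ∧
        ∀ x, μ x = μ₁ x * μ₂ x := by
  refine ⟨exists_prod_supp_of_cov_eq_zero hμ0 hμ hf hg, ?_⟩
  rintro ⟨A, ⟨f', hf'A, hff'⟩, ⟨g', hg'A, hgg'⟩, μ₁, μ₂, -, -, h₁, h₂, hμ12⟩
  exact cov_eq_zero_of_prod_supp hf'A hff' hg'A hgg' h₁ h₂ hμ12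

/-- **Strict FKG for an arbitrary log-supermodular `µ ≥ 0` on a product of finite chains**: `Ω(f,g) > 0` unless
the data (9.6)–(9.7) exist. [cite: ChanPak2026, Thm. 9.1; FortuinKasteleynGinibre1971, Prop. 1] -/
theorem cov_pos_of_forall_not_prod_supp {μ f g : (∀ i, α i) → ℝ} (hμ0 : ∀ x, 0 ≤ μ x)
    (hμ : IsLogSupermodular μ) (hf : Monotone f) (hg : Monotone g)
    (h : ∀ (A : Set ι) (f' g' μ₁ μ₂ : (∀ i, α i) → ℝ), DetBy f' A → (∀ x, μ x ≠ 0 → f x = f' x) →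
      DetBy g' Aᶜ → (∀ x, μ x ≠ 0 → g x = g' x) → (∀ x, 0 ≤ μ₁ x) → (∀ x, 0 ≤ μ₂ x) → DetBy μ₁ A →
      DetBy μ₂ Aᶜ → (∀ x, μ x = μ₁ x * μ₂ x) → False) :
    0 < cov μ f g := by
  refine lt_of_le_of_ne (cov_nonneg hμ0 hμ hf hg) fun h0 => ?_
  obtain ⟨A, ⟨f', hf'A, hff'⟩, ⟨g', hg'A, hgg'⟩, μ₁, μ₂, h1, h2, h3, h4, h5⟩ :=
    exists_prod_supp_of_cov_eq_zero hμ0 hμ hf hg h0.symm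
  exact h A f' g' μ₁ μ₂ hf'A hff' hg'A hgg' h1 h2 h3 h4 h5

/-- Normalised form for EVERY FKG probability weight on a product of finite chains (`IsFKGMeasure`: `µ ≥ 0`,
`Σµ = 1`, lattice condition — zeros allowed): for increasing `f, g`, `E(fg) = E(f)E(g)` iff (9.6)–(9.7).
This is the equality case of Sahi's `C₂` in the Sahi programme's vocabulary. [cite: ChanPak2026, Thm. 9.1] -/
theorem ex_mul_eq_ex_mul_ex_iff_supp {μ : (∀ i, α i) → ℝ}
    (hμ : Literature.Combinatorics.Sahi2008.IsFKGMeasure μ) {f g : (∀ i, α i) → ℝ} (hf : Monotone f)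
    (hg : Monotone g) :
    ex μ (f * g) = ex μ f * ex μ g ↔ ∃ A : Set ι,
      (∃ f' : (∀ i, α i) → ℝ, DetBy f' A ∧ ∀ x, μ x ≠ 0 → f x = f' x) ∧
      (∃ g' : (∀ i, α i) → ℝ, DetBy g' Aᶜ ∧ ∀ x, μ x ≠ 0 → g x = g' x) ∧
      ∃ μ₁ μ₂ : (∀ i, α i) → ℝ, (∀ x, 0 ≤ μ₁ x) ∧ (∀ x, 0 ≤ μ₂ x) ∧ DetBy μ₁ A ∧ DetBy μ₂ Aᶜ ∧
        ∀ x, μ x = μ₁ x * μ₂ x := by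
  rw [← cov_eq_zero_iff_exists_prod_supp hμ.nonneg hμ.mul_le_mul hf hg, cov, hμ.sum_eq_one, one_mul,
    sub_eq_zero]

end Support

end Literature.Probability.LatticeModels.FKGEqualityChains

/-! ### The Boolean lattice `2^ι` with an arbitrary support (Thm. 9.1 for chains of length `2`, `µ ≥ 0`)

The Boolean lattice `Set ι` IS (definitionally) the product of chains `Π _ : ι, Prop`; the statements of
`FKGEquality.lean` (`µ > 0` on `2^ι`) are completed here to `µ ≥ 0` by transporting
`FKGEqualityChains.cov_eq_zero_iff_exists_prod_supp` along this identification. -/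

namespace Literature.Probability.LatticeModels.FKGEquality

open Finset Function
open Literature.Combinatorics.Sahi2008 (ex ex_def)

variable {ι : Type*} [Fintype ι]

/-- The identification `2^ι = Π _ : ι, Prop` as an equivalence (both directions `rfl`). [folklore] -/
private def setEquivPi : Set ι ≃ (ι → Prop) where
  toFun ω i := i ∈ ω
  invFun x := {i | x i}
  left_inv _ := rfl
  right_inv _ := rfl

/-- Weighted sums over `2^ι` are the corresponding sums over `Π _ : ι, Prop`. [folklore] -/
private theorem ex_set_eq_ex_pi (μ h : Set ι → ℝ) :
    ex μ h = ex (α := ι → Prop) (fun x => μ {i | x i}) (fun x => h {i | x i}) := by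
  rw [ex_def, ex_def]
  exact Fintype.sum_equiv setEquivPi _ _ fun ω => rfl

/-- `Ω` on `2^ι` is `Ω` on `Π _ : ι, Prop`. [folklore] -/
private theorem cov_set_eq_cov_pi (μ f g : Set ι → ℝ) :
    cov μ f g = FKGEqualityChains.cov (α := fun _ : ι => Prop) (fun x => μ {i | x i}) (fun x => f {i | x i})
      (fun x => g {i | x i}) := by
  rw [cov, FKGEqualityChains.cov, ex_set_eq_ex_pi, ex_set_eq_ex_pi, ex_set_eq_ex_pi]
  have h0 : ∑ ω, μ ω = ∑ x : ι → Prop, μ {i | x i} := Fintype.sum_equiv setEquivPi _ _ fun ω => rfl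
  rw [h0]
  rfl

/-- **Chan–Pak 2026, Theorem 9.1 on the Boolean lattice `2^ι` with `µ ≥ 0` of arbitrary support** (the case of
chains of length two), completing `cov_eq_zero_iff_exists_prod` (`µ > 0`) of this file's vocabulary: for `µ ≥ 0`
log-supermodular and increasing `f, g`, `Σµ·Σµfg = Σµf·Σµg` iff for some `A ⊆ ι`, `f = f′` and `g = g′` on `supp µ`
with `f′(ω) = f′(ω ∩ A)`, `g′(ω) = g′(ω ∩ Aᶜ)` (9.6), and `µ(ω) = µ₁(ω ∩ A)·µ₂(ω ∖ A)` on all of `2^ι` with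
`µ₁, µ₂ ≥ 0` (9.7).  Proof: `FKGEqualityChains.cov_eq_zero_iff_exists_prod_supp` for the chains `α_i = Prop`.
[cite: ChanPak2026, Thm. 9.1] -/
theorem cov_eq_zero_iff_exists_prod_supp {μ f g : Set ι → ℝ} (hμ0 : ∀ ω, 0 ≤ μ ω) (hμ : IsLogSupermodular μ)
    (hf : Monotone f) (hg : Monotone g) :
    cov μ f g = 0 ↔ ∃ A : Set ι,
      (∃ f' : Set ι → ℝ, DetBy f' A ∧ ∀ ω, μ ω ≠ 0 → f ω = f' ω) ∧
      (∃ g' : Set ι → ℝ, DetBy g' Aᶜ ∧ ∀ ω, μ ω ≠ 0 → g ω = g' ω) ∧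
      ∃ μ₁ μ₂ : Set ι → ℝ, (∀ ω, 0 ≤ μ₁ ω) ∧ (∀ ω, 0 ≤ μ₂ ω) ∧ ∀ ω, μ ω = μ₁ (ω ∩ A) * μ₂ (ω \ A) := by
  -- the data on `Π _ : ι, Prop`
  set μP : (ι → Prop) → ℝ := fun x => μ {i | x i} with hμP
  set fP : (ι → Prop) → ℝ := fun x => f {i | x i} with hfP
  set gP : (ι → Prop) → ℝ := fun x => g {i | x i} with hgP
  have hset : ∀ x : ι → Prop, ({i | x i} : Set ι) = setEquivPi.symm x := fun x => rfl
  have hinf : ∀ x y : ι → Prop, ({i | (x ⊓ y) i} : Set ι) = {i | x i} ∩ {i | y i} := fun x y => by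
    ext i; simp only [Set.mem_setOf_eq, Pi.inf_apply, inf_Prop_eq, Set.mem_inter_iff]
  have hsup : ∀ x y : ι → Prop, ({i | (x ⊔ y) i} : Set ι) = {i | x i} ∪ {i | y i} := fun x y => by
    ext i; simp only [Set.mem_setOf_eq, Pi.sup_apply, sup_Prop_eq, Set.mem_union]
  have hle : ∀ {x y : ι → Prop}, x ≤ y → ({i | x i} : Set ι) ⊆ {i | y i} := fun hxy i hi => hxy i hi
  have hμP0 : ∀ x, 0 ≤ μP x := fun x => hμ0 _
  have hμPl : FKGEqualityChains.IsLogSupermodular (α := fun _ : ι => Prop) μP := fun x y => by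
    simp only [hμP, hinf, hsup]
    exact hμ _ _
  have hfPm : Monotone fP := fun x y hxy => hf (hle hxy)
  have hgPm : Monotone gP := fun x y hxy => hg (hle hxy)
  -- agreement on `A` in the two vocabularies
  have hagree : ∀ (A : Set ι) (x y : ι → Prop), (∀ i ∈ A, x i = y i) → ({i | x i} : Set ι) ∩ A = {i | y i} ∩ A :=
    fun A x y h => by
      ext i
      simp only [Set.mem_inter_iff, Set.mem_setOf_eq]
      exact ⟨fun hi => ⟨(h i hi.2) ▸ hi.1, hi.2⟩, fun hi => ⟨(h i hi.2).symm ▸ hi.1, hi.2⟩⟩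
  have hagreeD : ∀ (A : Set ι) (x y : ι → Prop), (∀ i ∈ Aᶜ, x i = y i) →
      ({i | x i} : Set ι) \ A = {i | y i} \ A :=
    fun A x y h => by
      ext i
      simp only [Set.mem_sdiff, Set.mem_setOf_eq]
      exact ⟨fun hi => ⟨(h i hi.2) ▸ hi.1, hi.2⟩, fun hi => ⟨(h i hi.2).symm ▸ hi.1, hi.2⟩⟩
  have hagree' : ∀ (A ω : Set ι), ∀ i ∈ A, (setEquivPi ω) i = (setEquivPi (ω ∩ A)) i := fun A ω i hi =>
    propext ⟨fun h => ⟨h, hi⟩, fun h => h.1⟩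
  have hagree'' : ∀ (A ω : Set ι), ∀ i ∈ Aᶜ, (setEquivPi ω) i = (setEquivPi (ω \ A)) i := fun A ω i hi =>
    propext ⟨fun h => ⟨h, hi⟩, fun h => h.1⟩
  rw [cov_set_eq_cov_pi, FKGEqualityChains.cov_eq_zero_iff_exists_prod_supp hμP0 hμPl hfPm hgPm]
  constructor
  · rintro ⟨A, ⟨f', hf'A, hff'⟩, ⟨g', hg'A, hgg'⟩, μ₁, μ₂, h1, h2, h3, h4, h5⟩
    refine ⟨A, ⟨fun ω => f' (setEquivPi ω), fun ω => hf'A _ _ (hagree' A ω), fun ω hω => hff' (setEquivPi ω) hω⟩,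
      ⟨fun ω => g' (setEquivPi ω), fun ω => hg'A _ _ fun i hi => ?_, fun ω hω => hgg' (setEquivPi ω) hω⟩,
      fun ω => μ₁ (setEquivPi ω), fun ω => μ₂ (setEquivPi ω), fun ω => h1 _, fun ω => h2 _, fun ω => ?_⟩
    · -- `ω` and `ω ∩ Aᶜ` agree off `A`
      exact propext ⟨fun h => ⟨h, hi⟩, fun h => h.1⟩
    · show μ ω = μ₁ (setEquivPi (ω ∩ A)) * μ₂ (setEquivPi (ω \ A))
      rw [← h3 _ _ (hagree' A ω), ← h4 _ _ (hagree'' A ω)]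
      exact h5 (setEquivPi ω)
  · rintro ⟨A, ⟨f', hf'A, hff'⟩, ⟨g', hg'A, hgg'⟩, μ₁, μ₂, h1, h2, h5⟩
    refine ⟨A, ⟨fun x => f' {i | x i}, fun x y hxy => ?_, fun x hx => hff' _ hx⟩,
      ⟨fun x => g' {i | x i}, fun x y hxy => ?_, fun x hx => hgg' _ hx⟩,
      fun x => μ₁ ({i | x i} ∩ A), fun x => μ₂ ({i | x i} \ A), fun x => h1 _, fun x => h2 _,
      fun x y hxy => ?_, fun x y hxy => ?_, fun x => h5 _⟩
    · show f' {i | x i} = f' {i | y i}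
      rw [hf'A {i | x i}, hf'A {i | y i}, hagree A x y hxy]
    · show g' {i | x i} = g' {i | y i}
      rw [hg'A {i | x i}, hg'A {i | y i}, hagree Aᶜ x y hxy]
    · show μ₁ ({i | x i} ∩ A) = μ₁ ({i | y i} ∩ A)
      rw [hagree A x y hxy]
    · show μ₂ ({i | x i} \ A) = μ₂ ({i | y i} \ A)
      rw [hagreeD A x y hxy]

/-- Normalised form on `2^ι` for EVERY FKG probability weight (`IsFKGMeasure`, zeros allowed): for increasing
`f, g`, `E(fg) = E(f)E(g)` iff (9.6)–(9.7). [cite: ChanPak2026, Thm. 9.1] -/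
theorem ex_mul_eq_ex_mul_ex_iff_supp {μ : Set ι → ℝ} (hμ : Literature.Combinatorics.Sahi2008.IsFKGMeasure μ)
    {f g : Set ι → ℝ} (hf : Monotone f) (hg : Monotone g) :
    ex μ (f * g) = ex μ f * ex μ g ↔ ∃ A : Set ι,
      (∃ f' : Set ι → ℝ, DetBy f' A ∧ ∀ ω, μ ω ≠ 0 → f ω = f' ω) ∧
      (∃ g' : Set ι → ℝ, DetBy g' Aᶜ ∧ ∀ ω, μ ω ≠ 0 → g ω = g' ω) ∧
      ∃ μ₁ μ₂ : Set ι → ℝ, (∀ ω, 0 ≤ μ₁ ω) ∧ (∀ ω, 0 ≤ μ₂ ω) ∧ ∀ ω, μ ω = μ₁ (ω ∩ A) * μ₂ (ω \ A) := by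
  rw [← cov_eq_zero_iff_exists_prod_supp hμ.nonneg hμ.mul_le_mul hf hg, cov, hμ.sum_eq_one, one_mul,
    sub_eq_zero]

/-! ### Strict FKG on `2^ι` with zeros allowed

The contrapositive of Theorem 9.1 `⇒` on the Boolean lattice for an arbitrary log-supermodular `µ ≥ 0`: the
FKG covariance is STRICTLY positive unless the data (9.6)–(9.7) exist.  This completes `cov_pos_of_forall_splits` /
`cov_pos_of_irreducible` of `FKGEquality.lean` (which assume `µ > 0`) to weights with zeros — e.g. conditional
product measures `µ( · | C)` of an increasing or decreasing event `C`, which are log-supermodular with support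
`C`. -/

/-- **Strict FKG on `2^ι` for an arbitrary log-supermodular `µ ≥ 0`** (zeros allowed): for increasing `f, g`,
`Σµ·Σµfg − Σµf·Σµg > 0` unless for some `A ⊆ ι` the data (9.6)–(9.7) exist (`f = f′(· ∩ A)`, `g = g′(· ∖ A)` on
`supp µ`, `µ(ω) = µ₁(ω ∩ A)µ₂(ω ∖ A)` with `µ₁, µ₂ ≥ 0`).
[cite: ChanPak2026, Thm. 9.1; FortuinKasteleynGinibre1971, Prop. 1] -/
theorem cov_pos_of_forall_not_prod_supp {μ f g : Set ι → ℝ} (hμ0 : ∀ ω, 0 ≤ μ ω) (hμ : IsLogSupermodular μ)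
    (hf : Monotone f) (hg : Monotone g)
    (h : ∀ (A : Set ι) (f' g' μ₁ μ₂ : Set ι → ℝ), DetBy f' A → (∀ ω, μ ω ≠ 0 → f ω = f' ω) →
      DetBy g' Aᶜ → (∀ ω, μ ω ≠ 0 → g ω = g' ω) → (∀ ω, 0 ≤ μ₁ ω) → (∀ ω, 0 ≤ μ₂ ω) →
      (∀ ω, μ ω = μ₁ (ω ∩ A) * μ₂ (ω \ A)) → False) :
    0 < cov μ f g := by
  refine lt_of_le_of_ne (cov_nonneg hμ0 hμ hf hg) fun h0 => ?_
  obtain ⟨A, ⟨f', hf'A, hff'⟩, ⟨g', hg'A, hgg'⟩, μ₁, μ₂, h1, h2, h5⟩ :=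
    (cov_eq_zero_iff_exists_prod_supp hμ0 hμ hf hg).1 h0.symm
  exact h A f' g' μ₁ μ₂ hf'A hff' hg'A hgg' h1 h2 h5

/-- **Strict FKG on `2^ι`, irreducible support form** (`µ ≥ 0` log-supermodular, zeros allowed): if `µ` admits
no product decomposition `µ(ω) = µ₁(ω ∩ A)µ₂(ω ∖ A)` (`µ₁, µ₂ ≥ 0`) along a PROPER nonempty `A ⊊ ι`, and the
increasing `f` and `g` are each non-constant on `supp µ`, then `Σµ·Σµfg > Σµf·Σµg`.  (With `A = ∅` the datum
(9.6) forces `f` constant on `supp µ`, with `A = ι` it forces `g` constant there.)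
[cite: ChanPak2026, Thm. 9.1; FortuinKasteleynGinibre1971, Prop. 1] -/
theorem cov_pos_of_irreducible_supp {μ f g : Set ι → ℝ} (hμ0 : ∀ ω, 0 ≤ μ ω) (hμ : IsLogSupermodular μ)
    (hirr : ∀ (A : Set ι) (μ₁ μ₂ : Set ι → ℝ), (∀ ω, 0 ≤ μ₁ ω) → (∀ ω, 0 ≤ μ₂ ω) →
      (∀ ω, μ ω = μ₁ (ω ∩ A) * μ₂ (ω \ A)) → A = ∅ ∨ A = Set.univ)
    (hf : Monotone f) (hg : Monotone g) (hfnc : ∃ a b, μ a ≠ 0 ∧ μ b ≠ 0 ∧ f a ≠ f b)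
    (hgnc : ∃ a b, μ a ≠ 0 ∧ μ b ≠ 0 ∧ g a ≠ g b) : 0 < cov μ f g := by
  refine cov_pos_of_forall_not_prod_supp hμ0 hμ hf hg fun A f' g' μ₁ μ₂ hf'A hff' hg'A hgg' h1 h2 h5 => ?_
  obtain ⟨a, b, ha, hb, hab⟩ := hfnc
  obtain ⟨a', b', ha', hb', hab'⟩ := hgnc
  rcases hirr A μ₁ μ₂ h1 h2 h5 with rfl | rfl
  · -- `f'` is determined by `∅`, hence constant: `f` is constant on the support
    refine hab ?_
    rw [hff' a ha, hff' b hb, hf'A a, hf'A b, Set.inter_empty, Set.inter_empty]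
  · -- `g'` is determined by `univᶜ = ∅`, hence constant: `g` is constant on the support
    refine hab' ?_
    rw [hgg' a' ha', hgg' b' hb', hg'A a', hg'A b', Set.compl_univ, Set.inter_empty, Set.inter_empty]

end Literature.Probability.LatticeModels.FKGEquality
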